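import Mathlib
import HarnessLib

/-!
# `NoHeavyLowerTail` (crux stmt-CriticalPhenomena-4575), antithetic vdBHK programme: KERNEL CERTIFICATE that the colouring poset of the
# 6-CROWN is NOT antipodal Kleitman (the counterexample of CROWN-counterexample.md, g45; memo FINDING-OBSTRUCTION-g46.md §4)

Support file (seat `prim-ineq-gen-7` gen 46; `--supports stmt-CriticalPhenomena-4575`).  No `sorry`, no definitions; one `decide` certificate.

THE OBJECT.  The crown `S₃` is the poset on `{0,…,5}` with minimal elements `0, 1, 3` and maximal elements `2 > 0,1`, `4 > 0,3`, `5 > 1,3`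
(principal down-sets, as bit masks: `↓0 = 1, ↓1 = 2, ↓2 = 7, ↓3 = 8, ↓4 = 25, ↓5 = 42`).  A 2-colouring of the crown is a bit mask `s < 64`
(bit `e` set = element `e` red); its red interior is `κ(s) = {e : ↓e ⊆ s}` (the largest down-set inside the red set) and its blue interior is
`κ(63 - s)`.  The colouring poset `Ω` (the 'antimatroid AK' object of FINDING-MULTISINK-g44 §0″ for the poset antimatroid of the crown, equivalently
the explicit RAA-type order of `…AntitheticRAAExplicit`) is
  `s ≼ t :⟺ κ(t) ⊆ κ(s) ∧ κ(s̄) ⊆ κ(t̄) ∧ s ∩ t̄ ⊆ κ(s) ∩ κ(t̄)`   (`s̄ = 63 - s` the complementary colouring),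
a partial order on the 64 colourings reversed by the fixed-point-free involution `ι s = s̄`.  ANTIPODAL KLEITMAN (up-set form, as in `…AntitheticApex`)
would say `#(A ∩ ι B) ≤ #(A ∩ B)` for all `≼`-up-sets `A, B`.
THE CERTIFICATE.  `AntitheticCrown.crown_not_antipodalKleitman`: for the up-sets `A = {s : bit s of 0x557f777f01110155}` (32 colourings) and
`B = {s : bit s of 0x30f1001070f30030}` (19 colourings) one has `#(A ∩ B) = 9 < 10 = #(A ∩ ι B)`.  (Found by kissat on the orbit-identity PB model,
kit j241376; the exact census of all 18,006,035 up-sets of `Ω` has 51 Hall-deficient up-sets, all of deficiency 1, kit j239564 / j241376.)  Hence the poset /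
antimatroid generalisation of CONJECTURE RAA ('every antimatroid, resp. every poset antimatroid, is AK') is FALSE, while RAA for graphs is untouched
(the crown is not a line-search antimatroid; cf. CONJECTURE C / D of the memo).  The statement quantifies the interior map `κ` and the relation `le` together
with their defining equations, so that no definition is introduced.
-/

namespace Summit.CriticalPhenomena.PercolationContinuityZ3.Theorems

namespace AntitheticCrown

/-- **The colouring poset of the 6-crown is not antipodal Kleitman** (kernel-checked certificate). With `κ` the red-interior map of the crown
(`↓`-masks `1, 2, 7, 8, 25, 42`) and `le` the colouring order `κ t ⊆ κ s ∧ κ s̄ ⊆ κ t̄ ∧ s ∩ t̄ ⊆ κ s ∩ κ t̄` on bit masks `< 64` (subset of masks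
written as `u &&& v = u`), there are two `le`-up-sets `A, B ⊆ Fin 64` with `#(A ∩ B) < #(A ∩ ιB)`, `ι s = 63 - s`. [this work; CROWN-counterexample.md] -/
theorem crown_not_antipodalKleitman
    (κ : ℕ → ℕ)
    (hκ : κ = fun s =>
      (if s &&& 1 = 1 then 1 else 0) + (if s &&& 2 = 2 then 2 else 0) + (if s &&& 7 = 7 then 4 else 0) +
      (if s &&& 8 = 8 then 8 else 0) + (if s &&& 25 = 25 then 16 else 0) + (if s &&& 42 = 42 then 32 else 0))
    (le : ℕ → ℕ → Prop)
    (hle : le = fun s t =>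
      κ t &&& κ s = κ t ∧ κ (63 - s) &&& κ (63 - t) = κ (63 - s) ∧
      (s &&& (63 - t)) &&& (κ s &&& κ (63 - t)) = s &&& (63 - t)) :
    ∃ A B : Finset (Fin 64),
      (∀ s ∈ A, ∀ t : Fin 64, le s.val t.val → t ∈ A) ∧
      (∀ s ∈ B, ∀ t : Fin 64, le s.val t.val → t ∈ B) ∧
      (A ∩ B).card < (A ∩ B.image (fun s : Fin 64 => (⟨63 - s.val, by omega⟩ : Fin 64))).card := by
  subst hκ
  subst hle
  refine ⟨Finset.univ.filter (fun s : Fin 64 => Nat.testBit 0x557f777f01110155 s.val = true),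
    Finset.univ.filter (fun s : Fin 64 => Nat.testBit 0x30f1001070f30030 s.val = true), ?_, ?_, ?_⟩
  · decide
  · decide
  · decide

end AntitheticCrown

end Summit.CriticalPhenomena.PercolationContinuityZ3.Theorems
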